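import Summits.HodgeConjecture.HodgeConjecture.Theorems.Q8SymplecticPowersCayleyParameters
import HarnessLib

/-!
# Commutator invariance ascends from `ℚ`-points to Cayley `K`-points — for the centraliser-isometry group of a PAIR
# `(S, T)` with `T⁻¹ S T = S⁻¹` (the quaternion deck pair), brick ASC-Q of programme K2Q

Cell `hodge-nonav`, prover seat `hodge-nonav-20241-p1` (g20); crux `PowersHodgeOfQuaternionCommutators`
(stmt-HodgeConjecture-24191, route `Q8SymplecticPowers`); memo `PROGRAMME-K2Q-20241p1-g20.md` brick ASC-Q. HELPER FILE
(`--supports stmt-HodgeConjecture-24191 --as helper`). Sorry-free; axioms standard.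

Twin of route A's `CyclicUnitaryPowersCayleyParameters` + `…CommutatorIdentity` + `…CommutatorAscent` (prover-Ax ∕ prover-Bx,
crux K2-A; Goodman–Wallach GTM 255 §2.2.3 Exercise 1 «Cayley parameters», Weyl's irrelevance of algebraic inequalities) with the
ONE deck matrix `S` (`S ^ p = 1`) replaced by a PAIR `S, T` of `G`-isometries with `S ^ p = 1`, `T ^ q = 1` and
`T⁻¹ S T = S⁻¹` — the cohomological quaternion pair `τ^*, j^*` (`p = q = 4`, `j⁻¹τj = τ⁻¹`). Data: rational `S, T, G` (`G`
symmetric nondegenerate, `Sᵀ G S = G = Tᵀ G T`) and a rational coefficient tensor `c` on words `Fin r → Fin N` fixed by the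
Kronecker power of every COMMUTATOR of invertible rational matrices commuting with `S` AND `T` and preserving `G`. Conclusion
(`commutator_invariance_ascends₂`): over every field `K` of characteristic zero, `c` is fixed by the Kronecker power of
`g h g⁻¹ h⁻¹` for all `K`-matrices `g, h` commuting with `S, T`, preserving `G`, with `det (1 + g)`, `det (1 + h)` invertible.

The only new algebra is the REYNOLDS MAP: `ρ₂ := cycAvg_T ∘ cycAvg_S ∘ skewPart` (`rho₂`) replaces route A's
`ρ = cycAvg_S ∘ skewPart`. Since conjugation by `T` swaps `S` and `S⁻¹` (`conj_pow_alt`), averaging over `⟨T⟩` preserves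
`S`-commutation (`cycAvg_comm_of_conj`); hence `ρ₂ M` commutes with `S` and `T` and is `G`-skew, and `ρ₂ = 2pq` on the Lie
algebra `{X : XS = SX, XT = TX, XᵀG + GX = 0}` (`rho₂_of_mem`). Everything else — Cayley numerators, the generic commutator
identity over `MvPolynomial`, the Cayley sections of `K`-points — is route A's, reused BY NAME or re-run verbatim with `ρ₂`.

* (part 1, `Q8SymplecticPowersCayleyParameters`) §1 `rho₂` and its properties; §2 `uNum₂`, `uDen₂`; §3 `innerPoly₂`, `denPoly₂`;
* §4 the field step `uDen₂_mul_sub_eq_zero` and the generic identity `innerPoly₂_eq_zero`;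
* §5 **`commutator_invariance_ascends₂`**.

Honest scope: matrix algebra; nothing here says HC, HC_CM or HC_AV is proved.

References: [GoodmanWallachGTM255] R. Goodman, N. Wallach, *Symmetry, Representations, and Invariants*, Exercises 1.4.5 #5 and
§2.2.3 Exercise 1.
-/

set_option linter.dupNamespace false

noncomputable section

open Matrix MvPolynomial
open scoped BigOperators

namespace Summit.HodgeConjecture.HodgeConjecture.Theorems.Q8SymplecticPowersCommutatorAscent

open Summit.HodgeConjecture.HodgeConjecture.Theorems.CyclicUnitaryPowersCayleyParameters
open Summit.HodgeConjecture.HodgeConjecture.Theorems.CyclicUnitaryPowersCommutatorIdentity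
open Summit.HodgeConjecture.HodgeConjecture.Theorems.CyclicUnitaryPowersCommutatorAscent
open Summit.HodgeConjecture.HodgeConjecture.Theorems.Q8SymplecticPowersCayleyParameters
open Literature.NumberTheory.DiophantineGeometry (tensorPowerMatrix tensorPowerMatrix_apply)

/-! ### §4 The field step and the generic identity -/

section FieldStep

variable {K : Type*} [Field K] {N : ℕ}

/-- **Field step for the pair**: if `c` is fixed by the Kronecker power of every commutator of unit-determinant
matrices commuting with `S` and `T` and preserving `G`, then `uDen₂ A B · ((uNum₂ A B)^{⊗r} c − (uDen₂ A B)^r c) = 0`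
for all `A, B`. [cite: GoodmanWallachGTM255, §2.2.3 Exercise 1] -/
theorem uDen₂_mul_sub_eq_zero {S Si T Ti G Gi : Matrix (Fin N) (Fin N) K} {p q : ℕ} (hSp : S ^ p = 1)
    (hSSi : S * Si = 1) (hSiS : Si * S = 1) (hSG : Sᵀ * G * S = G) (hTq : T ^ q = 1) (hTTi : T * Ti = 1)
    (hTiT : Ti * T = 1) (hTG : Tᵀ * G * T = G) (hTS : Ti * S * T = Si) (hTSi : Ti * Si * T = S) (hGt : Gᵀ = G)
    (hGit : Giᵀ = Gi) (hGGi : G * Gi = 1) (hGiG : Gi * G = 1) {r : ℕ} (c : (Fin r → Fin N) → K)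
    (hc : ∀ g h : Matrix (Fin N) (Fin N) K, IsUnit g.det → IsUnit h.det → g * S = S * g → h * S = S * h →
      g * T = T * g → h * T = T * h →
      gᵀ * G * g = G → hᵀ * G * h = G → tensorPowerMatrix K N r (g * h * g⁻¹ * h⁻¹) *ᵥ c = c)
    (A B : Matrix (Fin N) (Fin N) K) (w' : Fin r → Fin N) :
    uDen₂ S Si T Ti G Gi p q A B * ((tensorPowerMatrix K N r (uNum₂ S Si T Ti G Gi p q A B) *ᵥ c) w' -
      uDen₂ S Si T Ti G Gi p q A B ^ r * c w') = 0 := by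
  by_cases hD : uDen₂ S Si T Ti G Gi p q A B = 0
  · rw [hD, zero_mul]
  · have hD' := hD
    unfold uDen₂ at hD'
    simp only [mul_eq_zero, not_or] at hD'
    obtain ⟨⟨⟨hAp, hBp⟩, hAm⟩, hBm⟩ := hD'
    set X := rho₂ S Si T Ti G Gi p q A with hXdef
    set Y := rho₂ S Si T Ti G Gi p q B with hYdef
    have hXp : IsUnit (1 + X).det := isUnit_iff_ne_zero.mpr hAp
    have hYp : IsUnit (1 + Y).det := isUnit_iff_ne_zero.mpr hBp
    have hXm : IsUnit (1 - X).det := isUnit_iff_ne_zero.mpr hAm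
    have hYm : IsUnit (1 - Y).det := isUnit_iff_ne_zero.mpr hBm
    have hnum : uNum₂ S Si T Ti G Gi p q A B =
        uDen₂ S Si T Ti G Gi p q A B • (cayley X * cayley Y * (cayley X)⁻¹ * (cayley Y)⁻¹) := by
      unfold uNum₂ uDen₂
      exact commutator_numerator X Y hXp hXm hYp hYm
    have hinv := hc (cayley X) (cayley Y) (isUnit_det_cayley _ hXp hXm) (isUnit_det_cayley _ hYp hYm)
      (cayley_comm (rho₂_comm_S hSp hSSi hSiS hTTi hTiT hTS hTSi A) hXp)
      (cayley_comm (rho₂_comm_S hSp hSSi hSiS hTTi hTiT hTS hTSi B) hYp)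
      (cayley_comm (rho₂_comm_T (S := S) (Si := Si) (G := G) (Gi := Gi) (p := p) hTq hTTi hTiT A) hXp)
      (cayley_comm (rho₂_comm_T (S := S) (Si := Si) (G := G) (Gi := Gi) (p := p) hTq hTTi hTiT B) hYp)
      (cayley_transpose_mul_mul (rho₂_skew hSG hSSi hTG hTTi hGt hGit hGGi hGiG A) hXp)
      (cayley_transpose_mul_mul (rho₂_skew hSG hSSi hTG hTTi hGt hGit hGGi hGiG B) hYp)
    rw [hnum, tensorPowerMatrix_smul, Matrix.smul_mulVec, hinv, Pi.smul_apply, smul_eq_mul, sub_self,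
      mul_zero]

end FieldStep

section GenericIdentity

variable {N : ℕ}

/-- **The generic identity for the pair**: under the commutator-invariance hypothesis on `ℚ`-points, the inner
polynomial vanishes identically. [cite: GoodmanWallachGTM255, §2.2.3 Exercise 1] -/
theorem innerPoly₂_eq_zero {p q : ℕ} (S T G : Matrix (Fin N) (Fin N) ℚ) (hp : 0 < p) (hq : 0 < q)
    (hSp : S ^ p = 1) (hTq : T ^ q = 1) (hSG : Sᵀ * G * S = G) (hTG : Tᵀ * G * T = G)
    (hTS : T⁻¹ * S * T = S⁻¹) (hGt : Gᵀ = G) (hG : IsUnit G.det) {r : ℕ} (c : (Fin r → Fin N) → ℚ)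
    (hc : ∀ g h : Matrix (Fin N) (Fin N) ℚ, IsUnit g.det → IsUnit h.det → g * S = S * g → h * S = S * h →
      g * T = T * g → h * T = T * h →
      gᵀ * G * g = G → hᵀ * G * h = G → tensorPowerMatrix ℚ N r (g * h * g⁻¹ * h⁻¹) *ᵥ c = c)
    (w' : Fin r → Fin N) : innerPoly₂ S S⁻¹ T T⁻¹ G G⁻¹ p q r c w' = 0 := by
  have hSdet : IsUnit S.det := by
    have h := congrArg Matrix.det hSp
    rw [det_pow, det_one] at h
    exact IsUnit.of_pow_eq_one h hp.ne'
  have hTdet : IsUnit T.det := by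
    have h := congrArg Matrix.det hTq
    rw [det_pow, det_one] at h
    exact IsUnit.of_pow_eq_one h hq.ne'
  have hSSi : S * S⁻¹ = 1 := Matrix.mul_nonsing_inv _ hSdet
  have hSiS : S⁻¹ * S = 1 := Matrix.nonsing_inv_mul _ hSdet
  have hTTi : T * T⁻¹ = 1 := Matrix.mul_nonsing_inv _ hTdet
  have hTiT : T⁻¹ * T = 1 := Matrix.nonsing_inv_mul _ hTdet
  have hGGi : G * G⁻¹ = 1 := Matrix.mul_nonsing_inv _ hG
  have hGiG : G⁻¹ * G = 1 := Matrix.nonsing_inv_mul _ hG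
  have hGit : (G⁻¹)ᵀ = G⁻¹ := by rw [transpose_nonsing_inv, hGt]
  -- `T⁻¹ S⁻¹ T = S`: invert `T⁻¹ S T = S⁻¹`
  have hTSi : T⁻¹ * S⁻¹ * T = S := by
    have h1 : (T⁻¹ * S * T) * (T⁻¹ * S⁻¹ * T) = 1 := by
      calc (T⁻¹ * S * T) * (T⁻¹ * S⁻¹ * T) = T⁻¹ * S * (T * T⁻¹) * S⁻¹ * T := by simp only [Matrix.mul_assoc]
        _ = 1 := by rw [hTTi, Matrix.mul_one, Matrix.mul_assoc T⁻¹ S S⁻¹, hSSi, Matrix.mul_one, hTiT]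
    rw [hTS] at h1
    have h2 : S * (S⁻¹ * (T⁻¹ * S⁻¹ * T)) = S * 1 := by rw [h1]
    rwa [← Matrix.mul_assoc, hSSi, Matrix.one_mul, Matrix.mul_one] at h2
  have hvanish : denPoly₂ S S⁻¹ T T⁻¹ G G⁻¹ p q * innerPoly₂ S S⁻¹ T T⁻¹ G G⁻¹ p q r c w' = 0 := by
    apply MvPolynomial.funext
    intro a
    rw [map_zero, map_mul]
    set A : Matrix (Fin N) (Fin N) ℚ := Matrix.of fun i j => a (Sum.inl (i, j)) with hA
    set B : Matrix (Fin N) (Fin N) ℚ := Matrix.of fun i j => a (Sum.inr (i, j)) with hB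
    have k1 := aeval_innerPoly₂ (K := ℚ) S S⁻¹ T T⁻¹ G G⁻¹ p q r c w' A B
    have k2 := aeval_denPoly₂ (K := ℚ) S S⁻¹ T T⁻¹ G G⁻¹ p q A B
    rw [pt_of] at k1 k2
    rw [MvPolynomial.aeval_eq_eval] at k1 k2
    rw [k1, k2]
    simp only [Algebra.algebraMap_self, RingHom.id_apply]
    exact uDen₂_mul_sub_eq_zero hSp hSSi hSiS hSG hTq hTTi hTiT hTG hTS hTSi hGt hGit hGGi hGiG c hc A B w'
  exact (mul_eq_zero.mp hvanish).resolve_left (denPoly₂_ne_zero S S⁻¹ T T⁻¹ G G⁻¹ p q)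

end GenericIdentity

/-! ### §5 Main theorem -/

section Main

/-- **Commutator invariance ascends from `ℚ`-points to `K`-points (Cayley-parametrised part), for the
centraliser-isometry group of a pair `(S, T)` with `T⁻¹ S T = S⁻¹`.** Let `S, T, G` be rational `N × N` matrices with
`S ^ p = 1`, `T ^ q = 1` (`p, q > 0`), `G` symmetric with `det G ≠ 0`, `Sᵀ G S = G = Tᵀ G T`, `T⁻¹ S T = S⁻¹`, and let `c`
be a rational coefficient tensor on words of length `r` fixed by the Kronecker power of `g h g⁻¹ h⁻¹` for all invertible
rational `g, h` commuting with `S` and `T` and preserving `G`. Then for every field `K` of characteristic zero and all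
`K`-matrices `g, h` commuting with `S`, `T`, preserving `G` and with `det (1 + g)`, `det (1 + h)` invertible, the
Kronecker power of `g h g⁻¹ h⁻¹` fixes `c`. [cite: GoodmanWallachGTM255, Exercises 1.4.5 #5 and §2.2.3 Exercise 1] -/
theorem commutator_invariance_ascends₂ {N r p q : ℕ} (S T G : Matrix (Fin N) (Fin N) ℚ) (hp : 0 < p) (hq : 0 < q)
    (hSp : S ^ p = 1) (hTq : T ^ q = 1) (hSG : Sᵀ * G * S = G) (hTG : Tᵀ * G * T = G)
    (hTS : T⁻¹ * S * T = S⁻¹) (hGt : Gᵀ = G) (hG : IsUnit G.det)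
    (c : (Fin r → Fin N) → ℚ)
    (hc : ∀ g h : Matrix (Fin N) (Fin N) ℚ, IsUnit g.det → IsUnit h.det → g * S = S * g → h * S = S * h →
      g * T = T * g → h * T = T * h →
      gᵀ * G * g = G → hᵀ * G * h = G → tensorPowerMatrix ℚ N r (g * h * g⁻¹ * h⁻¹) *ᵥ c = c)
    {K : Type*} [Field K] [CharZero K] (g h : Matrix (Fin N) (Fin N) K)
    (hg1 : IsUnit (1 + g).det) (hh1 : IsUnit (1 + h).det)
    (hgS : g * S.map (algebraMap ℚ K) = S.map (algebraMap ℚ K) * g)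
    (hhS : h * S.map (algebraMap ℚ K) = S.map (algebraMap ℚ K) * h)
    (hgT : g * T.map (algebraMap ℚ K) = T.map (algebraMap ℚ K) * g)
    (hhT : h * T.map (algebraMap ℚ K) = T.map (algebraMap ℚ K) * h)
    (hgG : gᵀ * G.map (algebraMap ℚ K) * g = G.map (algebraMap ℚ K))
    (hhG : hᵀ * G.map (algebraMap ℚ K) * h = G.map (algebraMap ℚ K)) :
    tensorPowerMatrix K N r (g * h * g⁻¹ * h⁻¹) *ᵥ (fun w => algebraMap ℚ K (c w)) =
      fun w => algebraMap ℚ K (c w) := by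
  -- the structure over `ℚ`
  have hSdet : IsUnit S.det := by
    have e := congrArg Matrix.det hSp
    rw [det_pow, det_one] at e
    exact IsUnit.of_pow_eq_one e hp.ne'
  have hTdet : IsUnit T.det := by
    have e := congrArg Matrix.det hTq
    rw [det_pow, det_one] at e
    exact IsUnit.of_pow_eq_one e hq.ne'
  have hSSi : S * S⁻¹ = 1 := Matrix.mul_nonsing_inv _ hSdet
  have hSiS : S⁻¹ * S = 1 := Matrix.nonsing_inv_mul _ hSdet
  have hTTi : T * T⁻¹ = 1 := Matrix.mul_nonsing_inv _ hTdet
  have hTiT : T⁻¹ * T = 1 := Matrix.nonsing_inv_mul _ hTdet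
  have hGGi : G * G⁻¹ = 1 := Matrix.mul_nonsing_inv _ hG
  have hGiG : G⁻¹ * G = 1 := Matrix.nonsing_inv_mul _ hG
  -- its transport to `K`
  let φ : ℚ →+* K := algebraMap ℚ K
  have em : ∀ M : Matrix (Fin N) (Fin N) ℚ, M.map (algebraMap ℚ K) = φ.mapMatrix M := fun M => rfl
  have tmul : ∀ M M' : Matrix (Fin N) (Fin N) ℚ, M.map φ * M'.map φ = (M * M').map φ := fun M M' => by
    rw [em, em, em, ← map_mul]
  have tone : (1 : Matrix (Fin N) (Fin N) ℚ).map φ = 1 := by rw [em, map_one]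
  have tSSi : S.map φ * S⁻¹.map φ = 1 := by rw [tmul, hSSi, tone]
  have tSiS : S⁻¹.map φ * S.map φ = 1 := by rw [tmul, hSiS, tone]
  have tTTi : T.map φ * T⁻¹.map φ = 1 := by rw [tmul, hTTi, tone]
  have tTiT : T⁻¹.map φ * T.map φ = 1 := by rw [tmul, hTiT, tone]
  have tGiG : G⁻¹.map φ * G.map φ = 1 := by rw [tmul, hGiG, tone]
  have tGdet : (G.map φ).det ≠ 0 := by
    rw [em, ← RingHom.map_det]; exact (hG.map φ).ne_zero
  -- `g`, `h` are invertible
  have hdet : ∀ k : Matrix (Fin N) (Fin N) K, kᵀ * G.map φ * k = G.map φ → IsUnit k.det := by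
    intro k hk
    have e := congrArg Matrix.det hk
    rw [det_mul, det_mul, det_transpose] at e
    have e2 : k.det * k.det * (G.map φ).det = 1 * (G.map φ).det := by linear_combination e
    exact IsUnit.of_mul_eq_one _ (mul_right_cancel₀ tGdet e2)
  have hgd := hdet g hgG
  have hhd := hdet h hhG
  -- the two points `A`, `B` of the parameter space with `ρ₂ A = X`, `ρ₂ B = Y` (Cayley sections of `g`, `h`)
  have h2pq : ((2 * p * q : ℕ) : K) ≠ 0 := by
    have : 2 * p * q ≠ 0 := Nat.mul_ne_zero (by omega) hq.ne'
    exact_mod_cast this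
  have hrho : ∀ k : Matrix (Fin N) (Fin N) K, IsUnit (1 + k).det → k * S.map φ = S.map φ * k →
      k * T.map φ = T.map φ * k → kᵀ * G.map φ * k = G.map φ →
      rho₂ (S.map φ) (S⁻¹.map φ) (T.map φ) (T⁻¹.map φ) (G.map φ) (G⁻¹.map φ) p q
        (((2 * p * q : ℕ) : K)⁻¹ • ((1 - k) * (1 + k)⁻¹)) = (1 - k) * (1 + k)⁻¹ := by
    intro k hk1 hkS hkT hkG
    rw [rho₂_smul, rho₂_of_mem tSSi tSiS tTTi tTiT tGiG (section_comm k hk1 hkS) (section_comm k hk1 hkT)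
      (section_skew k hk1 hkG), ← Nat.cast_smul_eq_nsmul K, smul_smul, inv_mul_cancel₀ h2pq, one_smul]
  set A : Matrix (Fin N) (Fin N) K := ((2 * p * q : ℕ) : K)⁻¹ • ((1 - g) * (1 + g)⁻¹) with hA
  set B : Matrix (Fin N) (Fin N) K := ((2 * p * q : ℕ) : K)⁻¹ • ((1 - h) * (1 + h)⁻¹) with hB
  have hrA := hrho g hg1 hgS hgT hgG
  have hrB := hrho h hh1 hhS hhT hhG
  rw [← hA] at hrA
  rw [← hB] at hrB
  have hXp := isUnit_det_one_add_section g hg1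
  have hXm := isUnit_det_one_sub_section g hg1 hgd
  have hYp := isUnit_det_one_add_section h hh1
  have hYm := isUnit_det_one_sub_section h hh1 hhd
  -- the numerator and the denominator at `(A, B)`
  have hU : uNum₂ (S.map φ) (S⁻¹.map φ) (T.map φ) (T⁻¹.map φ) (G.map φ) (G⁻¹.map φ) p q A B =
      uDen₂ (S.map φ) (S⁻¹.map φ) (T.map φ) (T⁻¹.map φ) (G.map φ) (G⁻¹.map φ) p q A B •
        (g * h * g⁻¹ * h⁻¹) := by
    unfold uNum₂ uDen₂
    rw [hrA, hrB, commutator_numerator _ _ hXp hXm hYp hYm, cayley_section g hg1, cayley_section h hh1]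
  have hD : uDen₂ (S.map φ) (S⁻¹.map φ) (T.map φ) (T⁻¹.map φ) (G.map φ) (G⁻¹.map φ) p q A B ≠ 0 := by
    unfold uDen₂
    rw [hrA, hrB]
    exact mul_ne_zero (mul_ne_zero (mul_ne_zero hXp.ne_zero hYp.ne_zero) hXm.ne_zero) hYm.ne_zero
  -- evaluate the generic identity at `(A, B)`
  funext w'
  have k := aeval_innerPoly₂ (K := K) S S⁻¹ T T⁻¹ G G⁻¹ p q r c w' A B
  rw [innerPoly₂_eq_zero S T G hp hq hSp hTq hSG hTG hTS hGt hG c hc w', map_zero, hU, tensorPowerMatrix_smul,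
    Matrix.smul_mulVec, Pi.smul_apply, smul_eq_mul] at k
  exact mul_left_cancel₀ (pow_ne_zero r hD) (sub_eq_zero.mp k.symm)

end Main

end Summit.HodgeConjecture.HodgeConjecture.Theorems.Q8SymplecticPowersCommutatorAscent

end
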